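import Mathlib
import Literature.Computability.AlgebraicComplexity.GroupTheoreticMatMul
import Literature.Barriers.MatrixMultiplication.TricoloredSumFreeBarrier
import Summits.MatrixMultiplication.MatrixMultiplication.Theorems.GroupTheoreticSTPPCThesisPackingSumset
import Summits.MatrixMultiplication.MatrixMultiplication.Theorems.AbelianSTPPCensusIteratedRoom
import Summits.MatrixMultiplication.MatrixMultiplication.Theorems.AbelianSTPPCensusThreeRoomEnergy
import Summits.MatrixMultiplication.MatrixMultiplication.Theorems.AbelianSTPPCensusThreeRoomEnergyPlus

/-!
# The three-room energy rule with one pair class (E3⁺⁺) (cell mm-stpp; rule text mm-stpp-theory g9, kernel eng-2 g4)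

Refines `STPPThreeRoomEnergy.three_room_energy_plus` (E3⁺) by one more floor class inside the identity `Σ_g |W ∩ (W+g)| = V²`
(`W = A_t − B_t + C_t`, `|W| = V > |G|/2`, U14⁺ slacks `s_A, s_B, s_C`, `θ = V − Σ s`): the translate
`T = (A_t − B_t) − (a₀ − b₀)` (`a₀ ∈ A_t`, `b₀ ∈ B_t`; `|T| = |A_t||B_t|` by the TPP) consists of sums `(a − a₀) + (b₀ − b)` of an
`A`-difference and a `B`-difference, so every `g ∈ T` has `|W ∩ (W+g)| ≥ V − s_A − s_B` (one sub-additivity step); `T` meets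
`(C_t − C_t) ∖ {0}` not at all (TPP) and, after removing `0` and the punctured `A`- and `B`-difference sets, still carries at least
`|A_t||B_t| − 1 − |(A_t−A_t)∖0| − |(B_t−B_t)∖0|` new elements; an exchange argument (the floors `V − s_A`, `V − s_B` of the removed
elements dominate `V − s_A − s_B`) gives

**E3⁺⁺ (`three_room_energy_pairAB`).**  `E3⁺-left-hand side + (|A_t| − 1)(|B_t| − 1)·((V − s_A − s_B) − θ) ≤ V²`;
the pairs `(B,C)` and `(C,A)` follow by `IsSTPP.rotate` (kill schema `false_of_energy3pp` takes the pair `(A,B)` of the family as given;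
rotate the shape data to use another pair).  Reach (theory g9, HOME/mm-stpp-theory/ceiling_uniform.txt): one more order on uniform windows,
e.g. `(7,7,7)⁵` dies under E3 for `M ≤ 586`, E3⁺ `≤ 587`, E3⁺⁺ `≤ 588` (instance `no_777x5_at_588`).
WHAT THIS IS NOT: no `ω` statement, no census row; a necessary condition.
-/

-- single-conjunct summit: the mandated namespace repeats `MatrixMultiplication`.
set_option linter.dupNamespace false

namespace Summit.MatrixMultiplication.MatrixMultiplication.Theorems

namespace STPPThreeRoomEnergy

open Finset Literature.Computability.AlgebraicComplexity
open scoped Pointwise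

variable {G : Type*} [AddCommGroup G] [DecidableEq G] [Fintype G] {N : ℕ} {A B C : Fin N → Finset G}

/-- **E3⁺⁺, pair `(A,B)`.**  Hypotheses as in `three_room_energy_plus`; conclusion: its left-hand side plus
`(|A_t| − 1)(|B_t| − 1)·((V − s_A − s_B) − θ)` is still at most `V²`. [original] -/
theorem three_room_energy_pairAB (h : IsSTPP A B C) (hA : ∀ u, (A u).Nonempty) (hB : ∀ u, (B u).Nonempty)
    (hC : ∀ u, (C u).Nonempty) (t : Fin N) (sA sB sC : ℕ)
    (hsA : Fintype.card G ≤ (A t).card * (B t).card * (C t).card +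
      (∑ u ∈ univ.erase t, (B u).card * (C u).card) + sA)
    (hsB : Fintype.card G ≤ (A t).card * (B t).card * (C t).card +
      (∑ u ∈ univ.erase t, (C u).card * (A u).card) + sB)
    (hsC : Fintype.card G ≤ (A t).card * (B t).card * (C t).card +
      (∑ u ∈ univ.erase t, (A u).card * (B u).card) + sC)
    (hbig : Fintype.card G < 2 * ((A t).card * (B t).card * (C t).card)) :
    Fintype.card G * ((A t).card * (B t).card * (C t).card - (sA + sB + sC)) +
      ((A t).card * (B t).card * (C t).card - ((A t).card * (B t).card * (C t).card - (sA + sB + sC))) +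
      ((A t).card - 1) * (((A t).card * (B t).card * (C t).card - sA) -
        ((A t).card * (B t).card * (C t).card - (sA + sB + sC))) +
      ((B t).card - 1) * (((A t).card * (B t).card * (C t).card - sB) -
        ((A t).card * (B t).card * (C t).card - (sA + sB + sC))) +
      ((C t).card - 1) * (((A t).card * (B t).card * (C t).card - sC) -
        ((A t).card * (B t).card * (C t).card - (sA + sB + sC))) +
      ((A t).card - 1) * ((B t).card - 1) * (((A t).card * (B t).card * (C t).card - (sA + sB)) -
        ((A t).card * (B t).card * (C t).card - (sA + sB + sC))) ≤
      ((A t).card * (B t).card * (C t).card) ^ 2 := by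
  set W := A t - B t + C t with hW
  set V := (A t).card * (B t).card * (C t).card with hVdef
  have hV : W.card = V := STPPIteratedRoom.card_sub_add_eq h t
  set θ := V - (sA + sB + sC) with hθ
  set eA := (V - sA) - θ with heA
  set eB := (V - sB) - θ with heB
  set eC := (V - sC) - θ with heC
  set eT := (V - (sA + sB)) - θ with heT
  set PA := (A t - A t).erase 0 with hPA
  set PB := (B t - B t).erase 0 with hPB
  set PC := (C t - C t).erase 0 with hPC
  obtain ⟨a₀, ha₀⟩ := hA t
  obtain ⟨b₀, hb₀⟩ := hB t
  -- the translate `T` of `A_t − B_t` and its new part `T'`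
  set T := (A t - B t).image (· - (a₀ - b₀)) with hT
  set T' := T.filter (fun g => g ≠ 0 ∧ g ∉ PA ∧ g ∉ PB ∧ g ∉ PC) with hT'
  have hTcard : T.card = (A t).card * (B t).card := by
    rw [hT, card_image_of_injective _ (sub_left_injective), STPPPackingSumset.card_sub_eq h t (hC t)]
  -- floors
  have fT : ∀ g ∈ T, V ≤ (W.filter (· - g ∈ W)).card + (sA + sB) := by
    intro g hg
    rw [hT, mem_image] at hg
    obtain ⟨d, hd, rfl⟩ := hg
    obtain ⟨a, ha, b, hb, rfl⟩ := mem_sub.1 hd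
    have e : a - b - (a₀ - b₀) = (a - a₀) + (b₀ - b) := by abel
    have h1 := popular_A h hA t sA hsA (a - a₀) (sub_mem_sub ha ha₀)
    have h2 := popular_B h hA hB t sB hsB (b₀ - b) (sub_mem_sub hb₀ hb)
    have h3 := STPPIteratedRoom.overlap_add (A t - B t + C t) (a - a₀) (b₀ - b)
    rw [← hW, hV] at h1 h2 h3
    rw [e]; omega
  set f : G → ℕ := fun g => θ + (if g = 0 then V - θ else 0) + (if g ∈ PA then eA else 0) +
    (if g ∈ PB then eB else 0) + (if g ∈ PC then eC else 0) + (if g ∈ T' then eT else 0) with hf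
  have key : ∀ g, f g ≤ (W.filter (· - g ∈ W)).card := by
    intro g
    have h0 := popular_all h hA hB hC t sA sB sC hsA hsB hsC hbig g
    rw [← hW, hV] at h0
    by_cases hgT : g ∈ T'
    · have hg' := (mem_filter.1 hgT).2
      have hT0 := fT g (mem_filter.1 hgT).1
      simp only [hf, if_neg hg'.1, if_neg hg'.2.1, if_neg hg'.2.2.1, if_neg hg'.2.2.2, if_pos hgT, add_zero]
      omega
    by_cases hg : g = 0
    · subst hg
      have hz := STPPIteratedRoom.overlap_zero W
      have n1 : (0 : G) ∉ PA := fun hm => (mem_erase.1 hm).1 rfl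
      have n2 : (0 : G) ∉ PB := fun hm => (mem_erase.1 hm).1 rfl
      have n3 : (0 : G) ∉ PC := fun hm => (mem_erase.1 hm).1 rfl
      simp only [hf, if_true, if_neg n1, if_neg n2, if_neg n3, if_neg hgT, add_zero]
      rw [hz, hV]; omega
    · by_cases hgA : g ∈ PA
      · have n2 : g ∉ PB := fun hm =>
          hg (eq_zero_of_mem_sub_A_of_mem_sub_B h t (hC t) (mem_erase.1 hgA).2 (mem_erase.1 hm).2)
        have n3 : g ∉ PC := fun hm =>
          hg (eq_zero_of_mem_sub_A_of_mem_sub_C h t (hB t) (mem_erase.1 hgA).2 (mem_erase.1 hm).2)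
        have h1 := popular_A h hA t sA hsA g (mem_erase.1 hgA).2
        rw [← hW, hV] at h1
        simp only [hf, if_neg hg, if_pos hgA, if_neg n2, if_neg n3, if_neg hgT, add_zero]
        omega
      · by_cases hgB : g ∈ PB
        · have n3 : g ∉ PC := fun hm =>
            hg (eq_zero_of_mem_sub_B_of_mem_sub_C h t (hA t) (mem_erase.1 hgB).2 (mem_erase.1 hm).2)
          have h1 := popular_B h hA hB t sB hsB g (mem_erase.1 hgB).2
          rw [← hW, hV] at h1
          simp only [hf, if_neg hg, if_neg hgA, if_pos hgB, if_neg n3, if_neg hgT, add_zero]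
          omega
        · by_cases hgC : g ∈ PC
          · have h1 := STPPIteratedRoom.room_popular h hC t sC hsC g (mem_erase.1 hgC).2
            rw [← hW, hV] at h1
            simp only [hf, if_neg hg, if_neg hgA, if_neg hgB, if_pos hgC, if_neg hgT, add_zero]
            omega
          · simp only [hf, if_neg hg, if_neg hgA, if_neg hgB, if_neg hgC, if_neg hgT, add_zero]
            omega
  have hsum : ∑ g, f g = Fintype.card G * θ + (V - θ) + PA.card * eA + PB.card * eB + PC.card * eC +
      T'.card * eT := by
    simp only [hf, sum_add_distrib, sum_const, card_univ, smul_eq_mul, sum_ite_eq', mem_univ, if_true,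
      sum_ite_mem_univ]
  have hle : ∑ g, f g ≤ V ^ 2 := by
    rw [← hV, ← sum_overlap_eq_sq W]; exact sum_le_sum fun g _ => key g
  -- counting the new part: `|T'| + 1 + |PA| + |PB| ≥ |T| = ab` (T meets PC nowhere)
  have hTPC : ∀ g ∈ T, g ∉ PC := by
    intro g hg hgC
    rw [hT, mem_image] at hg
    obtain ⟨d, hd, rfl⟩ := hg
    obtain ⟨a, ha, b, hb, rfl⟩ := mem_sub.1 hd
    have hne := (mem_erase.1 hgC).1
    obtain ⟨c, hc, c', hc', he⟩ := mem_sub.1 (mem_erase.1 hgC).2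
    have keq : (a - a₀) + (b₀ - b) + (c' - c) = 0 := by
      have : c - c' = a - b - (a₀ - b₀) := he
      calc (a - a₀) + (b₀ - b) + (c' - c) = (a - b - (a₀ - b₀)) - (c - c') := by abel
        _ = 0 := by rw [this, sub_self]
    obtain ⟨-, -, hs, ht', -⟩ := h t t t a₀ ha₀ a ha b hb b₀ hb₀ c hc c' hc' keq
    apply hne
    rw [← hs, ht', sub_self]
  have hcount : (A t).card * (B t).card ≤ T'.card + 1 + PA.card + PB.card := by
    have hsplit : T ⊆ T' ∪ ({0} ∪ (PA ∩ T) ∪ (PB ∩ T)) := by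
      intro g hg
      by_cases h0 : g = 0
      · subst h0; simp
      by_cases h1 : g ∈ PA
      · exact mem_union_right _ (mem_union_left _ (mem_union_right _ (mem_inter.2 ⟨h1, hg⟩)))
      by_cases h2 : g ∈ PB
      · exact mem_union_right _ (mem_union_right _ (mem_inter.2 ⟨h2, hg⟩))
      · exact mem_union_left _ (mem_filter.2 ⟨hg, h0, h1, h2, hTPC g hg⟩)
    have := card_le_card hsplit
    have u1 := card_union_le T' ({0} ∪ (PA ∩ T) ∪ (PB ∩ T))
    have u2 := card_union_le ({0} ∪ (PA ∩ T)) (PB ∩ T)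
    have u3 := card_union_le ({0} : Finset G) (PA ∩ T)
    have i1 := card_le_card (inter_subset_left : PA ∩ T ⊆ PA)
    have i2 := card_le_card (inter_subset_left : PB ∩ T ⊆ PB)
    rw [card_singleton] at u3
    rw [hTcard] at this
    omega
  -- sizes of the punctured difference sets
  have hPAc := card_pred_le_card_sub_erase (A t)
  have hPBc := card_pred_le_card_sub_erase (B t)
  have hPCc := card_pred_le_card_sub_erase (C t)
  rw [← hPA] at hPAc; rw [← hPB] at hPBc; rw [← hPC] at hPCc
  -- the exchange: floors of removed elements dominate `eT`
  have heTA : eT ≤ eA := by rw [heT, heA]; omega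
  have heTB : eT ≤ eB := by rw [heT, heB]; omega
  obtain ⟨α, hα⟩ := Nat.exists_eq_add_of_le hPAc
  obtain ⟨β, hβ⟩ := Nat.exists_eq_add_of_le hPBc
  have hapos : 1 ≤ (A t).card := card_pos.2 ⟨a₀, ha₀⟩
  have hbpos : 1 ≤ (B t).card := card_pos.2 ⟨b₀, hb₀⟩
  have hab : (A t).card * (B t).card = ((A t).card - 1) * ((B t).card - 1) + ((A t).card - 1) + ((B t).card - 1) + 1 := by
    obtain ⟨a', ha'⟩ := Nat.exists_eq_add_of_le hapos
    obtain ⟨b', hb'⟩ := Nat.exists_eq_add_of_le hbpos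
    rw [ha', hb']; simp only [Nat.add_sub_cancel_left]; ring
  have hnT : ((A t).card - 1) * ((B t).card - 1) ≤ α + β + T'.card := by
    rw [hab, hα, hβ] at hcount; omega
  have hex : ((A t).card - 1) * eA + ((B t).card - 1) * eB + ((A t).card - 1) * ((B t).card - 1) * eT ≤
      PA.card * eA + PB.card * eB + T'.card * eT := by
    rw [hα, hβ, add_mul, add_mul]
    have h1 : α * eT ≤ α * eA := Nat.mul_le_mul_left α heTA
    have h2 : β * eT ≤ β * eB := Nat.mul_le_mul_left β heTB
    have h3 : ((A t).card - 1) * ((B t).card - 1) * eT ≤ (α + β + T'.card) * eT := Nat.mul_le_mul_right eT hnT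
    rw [add_mul, add_mul] at h3
    omega
  calc Fintype.card G * θ + (V - θ) + ((A t).card - 1) * eA + ((B t).card - 1) * eB + ((C t).card - 1) * eC +
        ((A t).card - 1) * ((B t).card - 1) * eT
      ≤ Fintype.card G * θ + (V - θ) + PA.card * eA + PB.card * eB + PC.card * eC + T'.card * eT := by
        have hc3 : ((C t).card - 1) * eC ≤ PC.card * eC := Nat.mul_le_mul_right eC hPCc
        omega
    _ = ∑ g, f g := hsum.symm
    _ ≤ V ^ 2 := hle

/-! ## Kill schema and an instance -/

/-- **Kill schema (E3⁺⁺, pair `(A,B)` of the data as given).**  As `false_of_energy3p` with the extra pair term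
`(a_t − 1)(b_t − 1)·((V − (s_A + s_B)) − θ)`; to use the pair `(B,C)` or `(C,A)` rotate the shape data `(a,b,c) ↦ (b,c,a)`
(the family rotates by `IsSTPP.rotate`). [original] -/
theorem false_of_energy3pp (h : IsSTPP A B C) {a b c : Fin N → ℕ} (ha : ∀ r, (A r).card = a r)
    (hb : ∀ r, (B r).card = b r) (hc : ∀ r, (C r).card = c r) (hpos : ∀ r, 0 < a r ∧ 0 < b r ∧ 0 < c r)
    {M : ℕ} (hM : Fintype.card G = M) (t : Fin N) (SA SB SC : ℕ)
    (hSA : SA = ∑ u ∈ univ.erase t, b u * c u) (hSB : SB = ∑ u ∈ univ.erase t, c u * a u)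
    (hSC : SC = ∑ u ∈ univ.erase t, a u * b u) (hbig : M < 2 * (a t * b t * c t))
    (hkill : (a t * b t * c t) ^ 2 <
      M * (a t * b t * c t - ((M - (a t * b t * c t + SA)) + (M - (a t * b t * c t + SB)) +
        (M - (a t * b t * c t + SC)))) +
      (a t * b t * c t - (a t * b t * c t - ((M - (a t * b t * c t + SA)) + (M - (a t * b t * c t + SB)) +
        (M - (a t * b t * c t + SC))))) +
      (a t - 1) * ((a t * b t * c t - (M - (a t * b t * c t + SA))) - (a t * b t * c t -
        ((M - (a t * b t * c t + SA)) + (M - (a t * b t * c t + SB)) + (M - (a t * b t * c t + SC))))) +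
      (b t - 1) * ((a t * b t * c t - (M - (a t * b t * c t + SB))) - (a t * b t * c t -
        ((M - (a t * b t * c t + SA)) + (M - (a t * b t * c t + SB)) + (M - (a t * b t * c t + SC))))) +
      (c t - 1) * ((a t * b t * c t - (M - (a t * b t * c t + SC))) - (a t * b t * c t -
        ((M - (a t * b t * c t + SA)) + (M - (a t * b t * c t + SB)) + (M - (a t * b t * c t + SC))))) +
      (a t - 1) * (b t - 1) * ((a t * b t * c t - ((M - (a t * b t * c t + SA)) + (M - (a t * b t * c t + SB)))) -
        (a t * b t * c t - ((M - (a t * b t * c t + SA)) + (M - (a t * b t * c t + SB)) +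
          (M - (a t * b t * c t + SC)))))) :
    False := by
  classical
  have hA : ∀ u, (A u).Nonempty := fun u => card_pos.1 (by rw [ha u]; exact (hpos u).1)
  have hB : ∀ u, (B u).Nonempty := fun u => card_pos.1 (by rw [hb u]; exact (hpos u).2.1)
  have hC : ∀ u, (C u).Nonempty := fun u => card_pos.1 (by rw [hc u]; exact (hpos u).2.2)
  have eA : ∑ u ∈ univ.erase t, (B u).card * (C u).card = SA := by
    rw [hSA]; exact sum_congr rfl fun u _ => by rw [hb u, hc u]
  have eB : ∑ u ∈ univ.erase t, (C u).card * (A u).card = SB := by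
    rw [hSB]; exact sum_congr rfl fun u _ => by rw [hc u, ha u]
  have eC : ∑ u ∈ univ.erase t, (A u).card * (B u).card = SC := by
    rw [hSC]; exact sum_congr rfl fun u _ => by rw [ha u, hb u]
  have := three_room_energy_pairAB h hA hB hC t (M - (a t * b t * c t + SA)) (M - (a t * b t * c t + SB))
    (M - (a t * b t * c t + SC)) (by rw [eA, ha t, hb t, hc t, hM]; omega)
    (by rw [eB, ha t, hb t, hc t, hM]; omega) (by rw [eC, ha t, hb t, hc t, hM]; omega)
    (by rw [ha t, hb t, hc t, hM]; exact hbig)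
  rw [ha t, hb t, hc t, hM] at this
  exact absurd this (not_le.2 hkill)

/-- **Order 588, shapes `(7,7,7)⁵`: impossible** (slacks `49, 49, 49`, `θ = 196`: E3 gives `588·196 = 115248`, E3⁺ adds
`147 + 3·6·98 = 1911`, the pair term adds `36·49 = 1764`; total `118923 > 117649 = 343²`).  At 589 the same list passes
E3⁺⁺ (`117427 ≤ 117649`) — the energy method's ceiling on this uniform window (theory g9, ceiling_uniform.txt).
[original] -/
theorem no_777x5_at_588 {A B C : Fin 5 → Finset G} (h : IsSTPP A B C)
    (hA : ∀ r, (A r).card = 7) (hB : ∀ r, (B r).card = 7) (hC : ∀ r, (C r).card = 7)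
    (hM : Fintype.card G = 588) : False :=
  false_of_energy3pp (a := fun _ => 7) (b := fun _ => 7) (c := fun _ => 7) h hA hB hC (by decide) hM 0 196 196 196
    (by decide) (by decide) (by decide) (by decide) (by decide)

/-! ## The first vQ-alive T_E object of the record dies under E3⁺⁺ (appended 2026-08-27, eng-2 g5)

eng-1 g5's oracle scans (kit j274236 / j274239, REF [197]/[203]) named `(8,6,6) + (7,7,6)² + (6,6,6) + (5,5,5)` at the abelian order `483`
as the first list alive under the registered instrument vQ := vP ∧ E3⁺ (kernel witness `AbelianSTPPCensusVP.vqCensusTE_fails_at_483`; E3⁺ slack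
of a `(7,7,6)` member exactly `452`).  The shelved pair rule E3⁺⁺ kills it: for the member `(7,7,6)` (index `1`) the off-member sums are
`S_A = 139`, `S_B = 151`, `S_C = 158`, the slacks `(50, 38, 31)`, `θ = 175`, and the pair-`(A,B)` term `(7−1)(7−1)·s_C = 36·31 = 1116 > 452`:
`e3pLHS + 1116 = 85 984 + 1116 = 87 100 > 294² = 86 436`.  (Seat scan of all 1 668 recorded vQ-alive witness lists of the two eng-1 jobs:
E3⁺⁺ kills 208 — every letter variant of the 483 list, the `(9,7,5)`-headed lists at 514–517, … — and the first E3⁺⁺-survivor is the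
SAME list `(8,6,6) + (7,7,6)² + (6,6,6) + (5,5,5)` at `484` (best pair `(B,C)`: `86 274 ≤ 86 436`, margin `162`), with its letter variants; its
sibling `(8,6,6) + (7,7,6) + (6,7,7) + (6,6,6) + (5,5,5)` is E3⁺⁺-KILLED at 484 (member `(6,7,7)`, pair `(B,C)`: `86 599 > 86 436`) — erratum
to the g5 wording of this sentence, REF N11; one order, as on uniform windows.) -/

/-- **Order 483, shapes `(8,6,6), (7,7,6), (7,7,6), (6,6,6), (5,5,5)`: impossible** in every abelian group of order `483` — the first
vQ-alive `T_E` list of the record (eng-1 j274239) is killed by E3⁺⁺ at its member `1 = (7,7,6)` with the pair `(A,B)`. [original] -/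
theorem no_866_776_776_666_555_at_483 {A B C : Fin 5 → Finset G} (h : IsSTPP A B C)
    (hA : ∀ r, (A r).card = ![8, 7, 7, 6, 5] r) (hB : ∀ r, (B r).card = ![6, 7, 7, 6, 5] r)
    (hC : ∀ r, (C r).card = ![6, 6, 6, 6, 5] r) (hM : Fintype.card G = 483) : False :=
  false_of_energy3pp (a := ![8, 7, 7, 6, 5]) (b := ![6, 7, 7, 6, 5]) (c := ![6, 6, 6, 6, 5]) h hA hB hC (by decide) hM 1 139 151 158
    (by decide) (by decide) (by decide) (by decide) (by decide)

/-! ## The first vQ-alive ORDER of the record, 472, dies under E3⁺⁺ (appended 2026-08-27, eng-2 g7)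

vp-p2 g1's budgeted kernel checker for vQ := vP ∧ E3⁺ (`checkQE`, leaf `noAbelianSTPPHostUpTo_250_417`) first fails at the abelian order `472`,
on the thin list `(6,6,8)⁴ + (3,4,4)` (`a = (6,6,6,6,3)`, `b = (6,6,6,6,4)`, `c = (8,8,8,8,4)`; `Σ V^{5/6} = 4·288^{5/6} + 48^{5/6} = 473.46`), and
REF [255] confirmed it ALIVE under every exact registered rule at `472` and `473` (E3⁺ left-hand side `82 564`, margin `380`, at 472; not
5/2-beating at 474; E3⁺-killed at 471).  The shelved pair rule E3⁺⁺ kills it at both orders, at a heavy member `(6,6,8)` (index `0`,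
`V = 288 > M/2`, off-member sums `S_A = 160`, `S_B = 156`, `S_C = 120`) with the pair `(A,B)`:
at `472` the slacks are `(24, 28, 64)`, `θ = 172`, pair term `(6−1)(6−1)·s_C = 25·64 = 1 600`, total `82 564 + 1 600 = 84 164 > 82 944 = 288²`;
at `473` the slacks are `(25, 29, 65)`, `θ = 169`, E3⁺ part `81 354`, pair term `25·65 = 1 625`, total `82 979 > 82 944` (margin `35`).
So no NEW rule is needed at 472/473; where vP ∧ E3⁺ ∧ E3⁺⁺ first goes blind is a separate census question (recorded candidates: the
`484` list above, margin `162`).  WHAT THIS IS NOT: no census number, no `ω` statement; two instances of p492675's schema. -/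

/-- **Order 472, shapes `(6,6,8)⁴ + (3,4,4)`: impossible** in every abelian group of order `472` — the first vQ-alive list of the record
(vp-p2 g1 / REF [255]) is killed by E3⁺⁺ at its member `0 = (6,6,8)` with the pair `(A,B)` (`84 164 > 82 944`). [original] -/
theorem no_6668x4_344_at_472 {A B C : Fin 5 → Finset G} (h : IsSTPP A B C)
    (hA : ∀ r, (A r).card = ![6, 6, 6, 6, 3] r) (hB : ∀ r, (B r).card = ![6, 6, 6, 6, 4] r)
    (hC : ∀ r, (C r).card = ![8, 8, 8, 8, 4] r) (hM : Fintype.card G = 472) : False :=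
  false_of_energy3pp (a := ![6, 6, 6, 6, 3]) (b := ![6, 6, 6, 6, 4]) (c := ![8, 8, 8, 8, 4]) h hA hB hC (by decide) hM 0 160 156 120
    (by decide) (by decide) (by decide) (by decide) (by decide)

/-- **Order 473, shapes `(6,6,8)⁴ + (3,4,4)`: impossible** in every abelian group of order `473` (the same list, still 5/2-beating and
vQ-alive there by REF [255]; E3⁺⁺ at member `0`, pair `(A,B)`: `82 979 > 82 944`, margin `35`). [original] -/
theorem no_6668x4_344_at_473 {A B C : Fin 5 → Finset G} (h : IsSTPP A B C)
    (hA : ∀ r, (A r).card = ![6, 6, 6, 6, 3] r) (hB : ∀ r, (B r).card = ![6, 6, 6, 6, 4] r)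
    (hC : ∀ r, (C r).card = ![8, 8, 8, 8, 4] r) (hM : Fintype.card G = 473) : False :=
  false_of_energy3pp (a := ![6, 6, 6, 6, 3]) (b := ![6, 6, 6, 6, 4]) (c := ![8, 8, 8, 8, 4]) h hA hB hC (by decide) hM 0 160 156 120
    (by decide) (by decide) (by decide) (by decide) (by decide)

end STPPThreeRoomEnergy

end Summit.MatrixMultiplication.MatrixMultiplication.Theorems
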